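import Summits.Parity.BatemanHorn.Theorems.AlmostPrimeZerosDefs

/-!
# drefute gen-2 — candidate POSITIVE pieces of `stub_typeILocal` (line `beta-thinned-root-kernel`)

Conjuncts (1) `0 ≤ b`, (2) `b(1) = 1`, (4) `b(p) = (y−1)Σᵢρᵢ(p)/p` (EVERY prime), (5) `b(p^ν) = 0 (ν > 2k)` of
`TypeILocal k f y`, proved against the TREE vocabulary `Theorems/AlmostPrimeZerosDefs.lean` with NO hypothesis on
`f` ((1) needs `1 ≤ y`).  Evidence for the lead prover (refuter may not land positive statements).
-/

open Finset Polynomial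
open scoped BigOperators

namespace Summit.Parity.BatemanHorn.Cruxes.SystemLSDRealSegment.BetaThinnedRootKernel.DrefuteG2

open Literature.NumberTheory.Sieve
open Summit.Parity.BatemanHorn.Cruxes.SystemLSDRealSegment.BetaThinnedRootKernel

/-! ### (1) non-negativity for `y ≥ 1` -/

theorem thinCoeff_nonneg {y : ℝ} (hy : 1 ≤ y) (v : ℕ) : 0 ≤ thinCoeff y v := by
  rcases Nat.lt_or_ge v 3 with h | h
  · interval_cases v
    · simp [thinCoeff]
    · simp [thinCoeff]; linarith
    · show (0 : ℝ) ≤ y ^ 2 - y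
      nlinarith
  · rw [thinCoeff_of_three_le y h]

theorem thinWeight_nonneg {y : ℝ} (hy : 1 ≤ y) (d : ℕ) : 0 ≤ thinWeight y d := by
  unfold thinWeight Finsupp.prod
  exact Finset.prod_nonneg fun p _ => thinCoeff_nonneg hy _

theorem tupleDens_nonneg {k : ℕ} (f : Fin k → ℤ[X]) (d : Fin k → ℕ) : 0 ≤ tupleDens f d := by
  unfold tupleDens
  positivity

theorem bCoeff_nonneg {k : ℕ} (f : Fin k → ℤ[X]) {y : ℝ} (hy : 1 ≤ y) (m : ℕ) : 0 ≤ bCoeff f y m := by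
  unfold bCoeff
  exact Finset.sum_nonneg fun d _ =>
    mul_nonneg (Finset.prod_nonneg fun i _ => thinWeight_nonneg hy _) (tupleDens_nonneg f d)

/-! ### (2) `b(1) = 1` -/

theorem prodTuples_one (k : ℕ) : prodTuples k 1 = {fun _ => 1} := by
  ext d
  simp only [prodTuples, Finset.mem_filter, Fintype.mem_piFinset, Nat.divisors_one, Finset.mem_singleton]
  constructor
  · rintro ⟨h, -⟩
    funext i
    exact h i
  · rintro rfl
    exact ⟨fun _ => rfl, by simp⟩

theorem tupleLcm_const_one (k : ℕ) : tupleLcm (fun _ : Fin k => (1 : ℕ)) = 1 := by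
  unfold tupleLcm
  apply Nat.eq_one_of_dvd_one
  exact Finset.lcm_dvd fun i _ => dvd_refl 1

theorem tupleCount_const_one {k : ℕ} (f : Fin k → ℤ[X]) : tupleCount f (fun _ : Fin k => (1 : ℕ)) = 1 := by
  unfold tupleCount
  rw [tupleLcm_const_one]
  simp

theorem tupleDens_const_one {k : ℕ} (f : Fin k → ℤ[X]) : tupleDens f (fun _ : Fin k => (1 : ℕ)) = 1 := by
  unfold tupleDens
  rw [tupleCount_const_one, tupleLcm_const_one]
  simp

theorem bCoeff_one {k : ℕ} (f : Fin k → ℤ[X]) (y : ℝ) : bCoeff f y 1 = 1 := by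
  unfold bCoeff
  rw [prodTuples_one, Finset.sum_singleton, tupleDens_const_one, mul_one]
  exact Finset.prod_eq_one fun i _ => thinWeight_one y

/-! ### (5) `b(p^ν) = 0` for `ν > 2k` -/

theorem mem_prodTuples_iff {k m : ℕ} {d : Fin k → ℕ} :
    d ∈ prodTuples k m ↔ (∀ i, d i ∈ m.divisors) ∧ ∏ i, d i = m := by
  simp [prodTuples, Fintype.mem_piFinset]

/-- A tuple of divisors of `p^ν` with product `p^ν` is `(p^{eᵢ})` with `Σ eᵢ = ν`. -/
theorem exists_exponents_of_mem_prodTuples {k : ℕ} {p : ℕ} (hp : p.Prime) {ν : ℕ} {d : Fin k → ℕ}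
    (hd : d ∈ prodTuples k (p ^ ν)) : ∃ e : Fin k → ℕ, (∀ i, d i = p ^ e i) ∧ ∑ i, e i = ν := by
  rw [mem_prodTuples_iff] at hd
  obtain ⟨hdiv, hprod⟩ := hd
  have h : ∀ i, ∃ e, e ≤ ν ∧ d i = p ^ e := fun i =>
    (Nat.dvd_prime_pow hp).1 (Nat.dvd_of_mem_divisors (hdiv i))
  choose e _he hde using h
  refine ⟨e, hde, ?_⟩
  have : p ^ (∑ i, e i) = p ^ ν := by
    rw [← hprod, Finset.prod_congr rfl fun i _ => hde i, Finset.prod_pow_eq_pow_sum]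
  exact Nat.pow_right_injective hp.two_le this

theorem bCoeff_prime_pow_eq_zero {k : ℕ} (f : Fin k → ℤ[X]) (y : ℝ) {p : ℕ} (hp : p.Prime) {ν : ℕ}
    (hν : 2 * k < ν) : bCoeff f y (p ^ ν) = 0 := by
  unfold bCoeff
  refine Finset.sum_eq_zero fun d hd => ?_
  obtain ⟨e, hde, hsum⟩ := exists_exponents_of_mem_prodTuples hp hd
  -- some exponent is ≥ 3, else Σ eᵢ ≤ 2k < ν
  have : ∃ i, 3 ≤ e i := by
    by_contra h
    push Not at h
    have : ∑ i, e i ≤ ∑ _i : Fin k, 2 := Finset.sum_le_sum fun i _ => Nat.lt_succ_iff.1 (h i)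
    rw [Finset.sum_const, Finset.card_univ, Fintype.card_fin, smul_eq_mul] at this
    omega
  obtain ⟨i, hi⟩ := this
  rw [Finset.prod_eq_zero (Finset.mem_univ i), zero_mul]
  rw [hde i, thinWeight_prime_pow y hp, thinCoeff_of_three_le y hi]

/-! ### (4) `b(p) = (y − 1) Σᵢ ρᵢ(p)/p` at every prime -/

/-- The single-slot tuple `(1,…,1,p,1,…,1)`. -/
def slot {k : ℕ} (i : Fin k) (p : ℕ) : Fin k → ℕ := Function.update (fun _ => 1) i p

theorem slot_apply_self {k : ℕ} (i : Fin k) (p : ℕ) : slot i p i = p := by simp [slot]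

theorem slot_apply_ne {k : ℕ} {i j : Fin k} (h : j ≠ i) (p : ℕ) : slot i p j = 1 := by simp [slot, h]

theorem slot_injective {k : ℕ} {p : ℕ} (hp : p ≠ 1) : Function.Injective fun i : Fin k => slot i p := by
  intro i j hij
  by_contra hne
  have h1 : slot i p i = slot j p i := congrFun hij i
  rw [slot_apply_self, slot_apply_ne hne] at h1
  exact hp h1

theorem prodTuples_prime {k : ℕ} {p : ℕ} (hp : p.Prime) :
    prodTuples k p = Finset.univ.image fun i : Fin k => slot i p := by
  ext d
  rw [mem_prodTuples_iff, Finset.mem_image]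
  constructor
  · rintro ⟨hdiv, hprod⟩
    -- p ∣ ∏ d ⇒ p ∣ d i for some i ⇒ d i = p
    have hpd : p ∣ ∏ i, d i := by rw [hprod]
    obtain ⟨i, -, hi⟩ := (Prime.dvd_finsetProd_iff hp.prime _).1 hpd
    have hdi : d i = p := Nat.dvd_antisymm (Nat.dvd_of_mem_divisors (hdiv i)) hi
    refine ⟨i, Finset.mem_univ _, ?_⟩
    -- the others multiply to 1
    have hrest : ∏ j ∈ Finset.univ.erase i, d j = 1 := by
      have := Finset.mul_prod_erase Finset.univ d (Finset.mem_univ i)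
      rw [hprod, hdi] at this
      exact (Nat.mul_right_inj hp.ne_zero).1 (this.trans (mul_one p).symm)
    have hone : ∀ j ∈ Finset.univ.erase i, d j = 1 :=
      (Finset.prod_eq_one_iff_of_one_le' fun j _ =>
        Nat.one_le_iff_ne_zero.2 (Nat.pos_of_mem_divisors (hdiv j)).ne').1 hrest
    funext j
    by_cases hj : j = i
    · subst hj; rw [slot_apply_self, hdi]
    · rw [slot_apply_ne hj, hone j (Finset.mem_erase.2 ⟨hj, Finset.mem_univ _⟩)]
  · rintro ⟨i, -, rfl⟩
    refine ⟨fun j => ?_, ?_⟩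
    · by_cases hj : j = i
      · subst hj; rw [slot_apply_self]; exact Nat.mem_divisors_self p hp.ne_zero
      · rw [slot_apply_ne hj]; exact Nat.one_mem_divisors.2 hp.ne_zero
    · rw [← Finset.mul_prod_erase Finset.univ _ (Finset.mem_univ i), slot_apply_self,
        Finset.prod_eq_one fun j hj => slot_apply_ne (Finset.ne_of_mem_erase hj) p, mul_one]

theorem tupleLcm_slot {k : ℕ} (i : Fin k) (p : ℕ) : tupleLcm (slot i p) = p := by
  unfold tupleLcm
  apply Nat.dvd_antisymm
  · refine Finset.lcm_dvd fun j _ => ?_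
    by_cases hj : j = i
    · subst hj; rw [slot_apply_self]
    · rw [slot_apply_ne hj]; exact one_dvd p
  · have := Finset.dvd_lcm (s := Finset.univ) (f := slot i p) (Finset.mem_univ i)
    rwa [slot_apply_self] at this

theorem tupleCount_slot {k : ℕ} (f : Fin k → ℤ[X]) (i : Fin k) (p : ℕ) :
    tupleCount f (slot i p) = polyRootCountMod ![f i] p := by
  unfold tupleCount polyRootCountMod
  rw [tupleLcm_slot]
  congr 1
  refine Finset.filter_congr fun n _ => ?_
  simp only [Fin.prod_univ_one, Matrix.cons_val_fin_one]
  constructor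
  · intro h
    simpa [slot_apply_self] using h i
  · intro h j
    by_cases hj : j = i
    · subst hj; simpa [slot_apply_self] using h
    · rw [slot_apply_ne hj]; simp

theorem prod_thinWeight_slot {k : ℕ} (y : ℝ) (i : Fin k) {p : ℕ} (hp : p.Prime) :
    ∏ j, thinWeight y (slot i p j) = y - 1 := by
  rw [← Finset.mul_prod_erase Finset.univ _ (Finset.mem_univ i), slot_apply_self, thinWeight_prime y hp,
    Finset.prod_eq_one fun j hj => by rw [slot_apply_ne (Finset.ne_of_mem_erase hj), thinWeight_one], mul_one]

/-- **TypeILocal (4)** at EVERY prime, for every family. -/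
theorem bCoeff_prime {k : ℕ} (f : Fin k → ℤ[X]) (y : ℝ) {p : ℕ} (hp : p.Prime) :
    bCoeff f y p = (y - 1) * ∑ i, (polyRootCountMod ![f i] p : ℝ) / p := by
  unfold bCoeff
  rw [prodTuples_prime hp, Finset.sum_image fun i _ j _ h => slot_injective hp.one_lt.ne' h, Finset.mul_sum]
  refine Finset.sum_congr rfl fun i _ => ?_
  rw [prod_thinWeight_slot y i hp, tupleDens, tupleCount_slot, tupleLcm_slot]

end Summit.Parity.BatemanHorn.Cruxes.SystemLSDRealSegment.BetaThinnedRootKernel.DrefuteG2
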